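import Summits.Ventures.PercRepro.S2DirectCell
import Summits.Ventures.PercRepro.S2FlatSharp
import Summits.Ventures.PercRepro.S2TailFlats
import Summits.Ventures.PercRepro.S2ThirteenSixSpreadNine
import Summits.Ventures.PercRepro.RankLevelSetPlaneTenPrime
import Summits.Ventures.PercRepro.S2ElevenEightK2NuSix
import Summits.Ventures.PercRepro.S2LPPhi

/-!
# PercRepro — S2: THE KEY CELLS `(12, d)`, `51 ≤ d ≤ 62` — THE ROW `p = 12` WITHOUT SUB-CELLS (p7, gen 20; sub-claim S2)

For each corank `d` here, `RLS M 12 5` on every `e`-free core of rank `12` on `12 + d` points (coloops allowed, no coloop split): the flat-sharp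
lever `topCount_le_flat_sharp` at the universal core bounds `(19, 10)` on the plain caps `cq3 d / avgChain16 d / avgChain5b d`, the tail by flats
at `(19, 10)`, and the KEY inequality `Φ(12, 5)·U + A ≤ Σ_{s=6}^{11} C(n, s)` (`c025_core_five_cell_key`, S2DirectCell; `Φ(12, 5) = 127 / 7`,
`S2LP.phiK_twelve_five`) — one numeral per cell (ratios `0.340`, `0.315`, `0.291`, `0.270`, `0.250`, `0.232`, `0.216`, `0.201`, `0.187`, `0.174`, `0.163`, `0.152`). The mirror of the row `p = 13` key cells
(S2ThirteenKeyCellsA/B, gen 19) at `p = 12`. Nothing about the window is claimed. Axioms: standard.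
-/

open scoped Matroid

namespace PercRepro

namespace ThmN

open Set

variable {α : Type}

set_option maxRecDepth 8192 in
/-- **The key cell `(12, 51)`**: `RLS M 12 5` on every `e`-free core of rank `12` on `63` points (caps `1326 / 49995 / 1930069`; `#U ≤ 1179987588444616915562197 / 86011480655100`,
`#{r ≤ 5} ≤ 1182068877186187884552257 / 86011480655100`, `Σ_{s=6}^{11} C(63, s) = 771757582528`; ratio `0.340`). -/
theorem c025_twelve_key_51 (M : Matroid α) [M.Finite]
    (hR : M.eRank = ((12 : ℕ) : ℕ∞)) (hn : M.E.ncard = 12 + 51)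
    (hfree : ∀ e ∈ M.E, ∃ A ⊆ M.E \ {e}, e ∉ M.closure A ∧ e ∉ M.closure ((M.E \ {e}) \ A)) : RLS M 12 5 := by
  classical
  have hd : M.E.encard = M.eRank + ((51 : ℕ) : ℕ∞) := by
    rw [hR, ← M.ground_finite.cast_ncard_eq, hn]
    push_cast
    ring
  have hs3 := TriangleCap.core_ncard_triangles_le_cq3 M hfree hd
  rw [show TriangleCap.cq3 51 = 1326 by decide] at hs3
  have hs4 := ncard_fourCircuits_le_avgChain16 51 M hfree hd
  rw [show avgChain16 51 = 49995 by decide] at hs4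
  have hs5 := S1.ncard_fiveCircuits_le_avgChain5b 51 M hfree hd
  rw [show S1.avgChain5b 51 = 1930069 by decide] at hs5
  have hflat : ∀ X ⊆ M.E, M.eRk X ≤ 5 → X.ncard ≤ 19 := fun X hX hr => ncard_le_nineteen_of_eRk_le_five_of_free M hfree hX hr
  have hflat' : ∀ X ⊆ M.E, M.eRk X ≤ 4 → X.ncard ≤ 10 := fun X hX hr => ncard_le_ten_of_eRk_le_four_of_free M hfree hX hr
  have hU := topCount_le_flat_sharp M 12 51 (by norm_num) (by norm_num) hR hn hfree 19 10 hflat hflat' (by norm_num) (by norm_num)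
    1326 49995 1930069 hs3 hs4 hs5
  have hA := ncard_eRk_le_five_le_flats M 12 51 (by norm_num) hR hn hfree 19 10 hflat hflat' (by norm_num) (by norm_num)
    (by norm_num) (by norm_num) 1326 49995 1930069 hs3 hs4 hs5
  rw [RLS_iff]
  refine c025_core_five_cell_key M 12 51 hn _ hU _ hA (phiK 12 5) (by rw [S2LP.phiK_twelve_five]; norm_num) ?_
  rw [S2LP.phiK_twelve_five]
  norm_num [Finset.sum_range_succ, Finset.sum_Icc_succ_top, Nat.choose]

set_option maxRecDepth 8192 in
/-- **The key cell `(12, 52)`**: `RLS M 12 5` on every `e`-free core of rank `12` on `64` points (caps `1378 / 53768 / 2115652`; `#U ≤ 354293866977453051706 / 23246346123`,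
`#{r ≤ 5} ≤ 1774523826801451062622 / 116231730615`, `Σ_{s=6}^{11} C(64, s) = 927731937080`; ratio `0.315`). -/
theorem c025_twelve_key_52 (M : Matroid α) [M.Finite]
    (hR : M.eRank = ((12 : ℕ) : ℕ∞)) (hn : M.E.ncard = 12 + 52)
    (hfree : ∀ e ∈ M.E, ∃ A ⊆ M.E \ {e}, e ∉ M.closure A ∧ e ∉ M.closure ((M.E \ {e}) \ A)) : RLS M 12 5 := by
  classical
  have hd : M.E.encard = M.eRank + ((52 : ℕ) : ℕ∞) := by
    rw [hR, ← M.ground_finite.cast_ncard_eq, hn]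
    push_cast
    ring
  have hs3 := TriangleCap.core_ncard_triangles_le_cq3 M hfree hd
  rw [show TriangleCap.cq3 52 = 1378 by decide] at hs3
  have hs4 := ncard_fourCircuits_le_avgChain16 52 M hfree hd
  rw [show avgChain16 52 = 53768 by decide] at hs4
  have hs5 := S1.ncard_fiveCircuits_le_avgChain5b 52 M hfree hd
  rw [show S1.avgChain5b 52 = 2115652 by decide] at hs5
  have hflat : ∀ X ⊆ M.E, M.eRk X ≤ 5 → X.ncard ≤ 19 := fun X hX hr => ncard_le_nineteen_of_eRk_le_five_of_free M hfree hX hr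
  have hflat' : ∀ X ⊆ M.E, M.eRk X ≤ 4 → X.ncard ≤ 10 := fun X hX hr => ncard_le_ten_of_eRk_le_four_of_free M hfree hX hr
  have hU := topCount_le_flat_sharp M 12 52 (by norm_num) (by norm_num) hR hn hfree 19 10 hflat hflat' (by norm_num) (by norm_num)
    1378 53768 2115652 hs3 hs4 hs5
  have hA := ncard_eRk_le_five_le_flats M 12 52 (by norm_num) hR hn hfree 19 10 hflat hflat' (by norm_num) (by norm_num)
    (by norm_num) (by norm_num) 1378 53768 2115652 hs3 hs4 hs5
  rw [RLS_iff]
  refine c025_core_five_cell_key M 12 52 hn _ hU _ hA (phiK 12 5) (by rw [S2LP.phiK_twelve_five]; norm_num) ?_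
  rw [S2LP.phiK_twelve_five]
  norm_num [Finset.sum_range_succ, Finset.sum_Icc_succ_top, Nat.choose]

set_option maxRecDepth 8192 in
/-- **The key cell `(12, 53)`**: `RLS M 12 5` on every `e`-free core of rank `12` on `65` points (caps `1431 / 57750 / 2315241`; `#U ≤ 80759115970244715113559 / 4778415591950`,
`#{r ≤ 5} ≤ 242685918603918726547957 / 14335246775850`, `Σ_{s=6}^{11} C(65, s) = 1111875716848`; ratio `0.291`). -/
theorem c025_twelve_key_53 (M : Matroid α) [M.Finite]
    (hR : M.eRank = ((12 : ℕ) : ℕ∞)) (hn : M.E.ncard = 12 + 53)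
    (hfree : ∀ e ∈ M.E, ∃ A ⊆ M.E \ {e}, e ∉ M.closure A ∧ e ∉ M.closure ((M.E \ {e}) \ A)) : RLS M 12 5 := by
  classical
  have hd : M.E.encard = M.eRank + ((53 : ℕ) : ℕ∞) := by
    rw [hR, ← M.ground_finite.cast_ncard_eq, hn]
    push_cast
    ring
  have hs3 := TriangleCap.core_ncard_triangles_le_cq3 M hfree hd
  rw [show TriangleCap.cq3 53 = 1431 by decide] at hs3
  have hs4 := ncard_fourCircuits_le_avgChain16 53 M hfree hd
  rw [show avgChain16 53 = 57750 by decide] at hs4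
  have hs5 := S1.ncard_fiveCircuits_le_avgChain5b 53 M hfree hd
  rw [show S1.avgChain5b 53 = 2315241 by decide] at hs5
  have hflat : ∀ X ⊆ M.E, M.eRk X ≤ 5 → X.ncard ≤ 19 := fun X hX hr => ncard_le_nineteen_of_eRk_le_five_of_free M hfree hX hr
  have hflat' : ∀ X ⊆ M.E, M.eRk X ≤ 4 → X.ncard ≤ 10 := fun X hX hr => ncard_le_ten_of_eRk_le_four_of_free M hfree hX hr
  have hU := topCount_le_flat_sharp M 12 53 (by norm_num) (by norm_num) hR hn hfree 19 10 hflat hflat' (by norm_num) (by norm_num)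
    1431 57750 2315241 hs3 hs4 hs5
  have hA := ncard_eRk_le_five_le_flats M 12 53 (by norm_num) hR hn hfree 19 10 hflat hflat' (by norm_num) (by norm_num)
    (by norm_num) (by norm_num) 1431 57750 2315241 hs3 hs4 hs5
  rw [RLS_iff]
  refine c025_core_five_cell_key M 12 53 hn _ hU _ hA (phiK 12 5) (by rw [S2LP.phiK_twelve_five]; norm_num) ?_
  rw [S2LP.phiK_twelve_five]
  norm_num [Finset.sum_range_succ, Finset.sum_Icc_succ_top, Nat.choose]

set_option maxRecDepth 8192 in
/-- **The key cell `(12, 54)`**: `RLS M 12 5` on every `e`-free core of rank `12` on `66` points (caps `1485 / 61950 / 2529615`; `#U ≤ 268196067844290516157471 / 14335246775850`,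
`#{r ≤ 5} ≤ 268638602786662131250471 / 14335246775850`, `Σ_{s=6}^{11} C(66, s) = 1328690696944`; ratio `0.270`). -/
theorem c025_twelve_key_54 (M : Matroid α) [M.Finite]
    (hR : M.eRank = ((12 : ℕ) : ℕ∞)) (hn : M.E.ncard = 12 + 54)
    (hfree : ∀ e ∈ M.E, ∃ A ⊆ M.E \ {e}, e ∉ M.closure A ∧ e ∉ M.closure ((M.E \ {e}) \ A)) : RLS M 12 5 := by
  classical
  have hd : M.E.encard = M.eRank + ((54 : ℕ) : ℕ∞) := by
    rw [hR, ← M.ground_finite.cast_ncard_eq, hn]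
    push_cast
    ring
  have hs3 := TriangleCap.core_ncard_triangles_le_cq3 M hfree hd
  rw [show TriangleCap.cq3 54 = 1485 by decide] at hs3
  have hs4 := ncard_fourCircuits_le_avgChain16 54 M hfree hd
  rw [show avgChain16 54 = 61950 by decide] at hs4
  have hs5 := S1.ncard_fiveCircuits_le_avgChain5b 54 M hfree hd
  rw [show S1.avgChain5b 54 = 2529615 by decide] at hs5
  have hflat : ∀ X ⊆ M.E, M.eRk X ≤ 5 → X.ncard ≤ 19 := fun X hX hr => ncard_le_nineteen_of_eRk_le_five_of_free M hfree hX hr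
  have hflat' : ∀ X ⊆ M.E, M.eRk X ≤ 4 → X.ncard ≤ 10 := fun X hX hr => ncard_le_ten_of_eRk_le_four_of_free M hfree hX hr
  have hU := topCount_le_flat_sharp M 12 54 (by norm_num) (by norm_num) hR hn hfree 19 10 hflat hflat' (by norm_num) (by norm_num)
    1485 61950 2529615 hs3 hs4 hs5
  have hA := ncard_eRk_le_five_le_flats M 12 54 (by norm_num) hR hn hfree 19 10 hflat hflat' (by norm_num) (by norm_num)
    (by norm_num) (by norm_num) 1485 61950 2529615 hs3 hs4 hs5
  rw [RLS_iff]
  refine c025_core_five_cell_key M 12 54 hn _ hU _ hA (phiK 12 5) (by rw [S2LP.phiK_twelve_five]; norm_num) ?_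
  rw [S2LP.phiK_twelve_five]
  norm_num [Finset.sum_range_succ, Finset.sum_Icc_succ_top, Nat.choose]

set_option maxRecDepth 8192 in
/-- **The key cell `(12, 55)`**: `RLS M 12 5` on every `e`-free core of rank `12` on `67` points (caps `1540 / 66375 / 2759580`; `#U ≤ 355662110911146691305809 / 17202296131020`,
`#{r ≤ 5} ≤ 356236568217852900141719 / 17202296131020`, `Σ_{s=6}^{11} C(67, s) = 1583307534848`; ratio `0.250`). -/
theorem c025_twelve_key_55 (M : Matroid α) [M.Finite]
    (hR : M.eRank = ((12 : ℕ) : ℕ∞)) (hn : M.E.ncard = 12 + 55)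
    (hfree : ∀ e ∈ M.E, ∃ A ⊆ M.E \ {e}, e ∉ M.closure A ∧ e ∉ M.closure ((M.E \ {e}) \ A)) : RLS M 12 5 := by
  classical
  have hd : M.E.encard = M.eRank + ((55 : ℕ) : ℕ∞) := by
    rw [hR, ← M.ground_finite.cast_ncard_eq, hn]
    push_cast
    ring
  have hs3 := TriangleCap.core_ncard_triangles_le_cq3 M hfree hd
  rw [show TriangleCap.cq3 55 = 1540 by decide] at hs3
  have hs4 := ncard_fourCircuits_le_avgChain16 55 M hfree hd
  rw [show avgChain16 55 = 66375 by decide] at hs4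
  have hs5 := S1.ncard_fiveCircuits_le_avgChain5b 55 M hfree hd
  rw [show S1.avgChain5b 55 = 2759580 by decide] at hs5
  have hflat : ∀ X ⊆ M.E, M.eRk X ≤ 5 → X.ncard ≤ 19 := fun X hX hr => ncard_le_nineteen_of_eRk_le_five_of_free M hfree hX hr
  have hflat' : ∀ X ⊆ M.E, M.eRk X ≤ 4 → X.ncard ≤ 10 := fun X hX hr => ncard_le_ten_of_eRk_le_four_of_free M hfree hX hr
  have hU := topCount_le_flat_sharp M 12 55 (by norm_num) (by norm_num) hR hn hfree 19 10 hflat hflat' (by norm_num) (by norm_num)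
    1540 66375 2759580 hs3 hs4 hs5
  have hA := ncard_eRk_le_five_le_flats M 12 55 (by norm_num) hR hn hfree 19 10 hflat hflat' (by norm_num) (by norm_num)
    (by norm_num) (by norm_num) 1540 66375 2759580 hs3 hs4 hs5
  rw [RLS_iff]
  refine c025_core_five_cell_key M 12 55 hn _ hU _ hA (phiK 12 5) (by rw [S2LP.phiK_twelve_five]; norm_num) ?_
  rw [S2LP.phiK_twelve_five]
  norm_num [Finset.sum_range_succ, Finset.sum_Icc_succ_top, Nat.choose]

set_option maxRecDepth 8192 in
/-- **The key cell `(12, 56)`**: `RLS M 12 5` on every `e`-free core of rank `12` on `68` points (caps `1596 / 71032 / 3005971`; `#U ≤ 280285283824550014602409 / 12287354379300`,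
`#{r ≤ 5} ≤ 31192067687291794507871 / 1365261597700`, `Σ_{s=6}^{11} C(68, s) = 1881561382168`; ratio `0.232`). -/
theorem c025_twelve_key_56 (M : Matroid α) [M.Finite]
    (hR : M.eRank = ((12 : ℕ) : ℕ∞)) (hn : M.E.ncard = 12 + 56)
    (hfree : ∀ e ∈ M.E, ∃ A ⊆ M.E \ {e}, e ∉ M.closure A ∧ e ∉ M.closure ((M.E \ {e}) \ A)) : RLS M 12 5 := by
  classical
  have hd : M.E.encard = M.eRank + ((56 : ℕ) : ℕ∞) := by
    rw [hR, ← M.ground_finite.cast_ncard_eq, hn]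
    push_cast
    ring
  have hs3 := TriangleCap.core_ncard_triangles_le_cq3 M hfree hd
  rw [show TriangleCap.cq3 56 = 1596 by decide] at hs3
  have hs4 := ncard_fourCircuits_le_avgChain16 56 M hfree hd
  rw [show avgChain16 56 = 71032 by decide] at hs4
  have hs5 := S1.ncard_fiveCircuits_le_avgChain5b 56 M hfree hd
  rw [show S1.avgChain5b 56 = 3005971 by decide] at hs5
  have hflat : ∀ X ⊆ M.E, M.eRk X ≤ 5 → X.ncard ≤ 19 := fun X hX hr => ncard_le_nineteen_of_eRk_le_five_of_free M hfree hX hr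
  have hflat' : ∀ X ⊆ M.E, M.eRk X ≤ 4 → X.ncard ≤ 10 := fun X hX hr => ncard_le_ten_of_eRk_le_four_of_free M hfree hX hr
  have hU := topCount_le_flat_sharp M 12 56 (by norm_num) (by norm_num) hR hn hfree 19 10 hflat hflat' (by norm_num) (by norm_num)
    1596 71032 3005971 hs3 hs4 hs5
  have hA := ncard_eRk_le_five_le_flats M 12 56 (by norm_num) hR hn hfree 19 10 hflat hflat' (by norm_num) (by norm_num)
    (by norm_num) (by norm_num) 1596 71032 3005971 hs3 hs4 hs5
  rw [RLS_iff]
  refine c025_core_five_cell_key M 12 56 hn _ hU _ hA (phiK 12 5) (by rw [S2LP.phiK_twelve_five]; norm_num) ?_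
  rw [S2LP.phiK_twelve_five]
  norm_num [Finset.sum_range_succ, Finset.sum_Icc_succ_top, Nat.choose]

set_option maxRecDepth 8192 in
/-- **The key cell `(12, 57)`**: `RLS M 12 5` on every `e`-free core of rank `12` on `69` points (caps `1653 / 75930 / 3269652`; `#U ≤ 2161229359024662913707073 / 86011480655100`,
`#{r ≤ 5} ≤ 2164578214838291821219003 / 86011480655100`, `Σ_{s=6}^{11} C(69, s) = 2230075162640`; ratio `0.216`). -/
theorem c025_twelve_key_57 (M : Matroid α) [M.Finite]
    (hR : M.eRank = ((12 : ℕ) : ℕ∞)) (hn : M.E.ncard = 12 + 57)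
    (hfree : ∀ e ∈ M.E, ∃ A ⊆ M.E \ {e}, e ∉ M.closure A ∧ e ∉ M.closure ((M.E \ {e}) \ A)) : RLS M 12 5 := by
  classical
  have hd : M.E.encard = M.eRank + ((57 : ℕ) : ℕ∞) := by
    rw [hR, ← M.ground_finite.cast_ncard_eq, hn]
    push_cast
    ring
  have hs3 := TriangleCap.core_ncard_triangles_le_cq3 M hfree hd
  rw [show TriangleCap.cq3 57 = 1653 by decide] at hs3
  have hs4 := ncard_fourCircuits_le_avgChain16 57 M hfree hd
  rw [show avgChain16 57 = 75930 by decide] at hs4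
  have hs5 := S1.ncard_fiveCircuits_le_avgChain5b 57 M hfree hd
  rw [show S1.avgChain5b 57 = 3269652 by decide] at hs5
  have hflat : ∀ X ⊆ M.E, M.eRk X ≤ 5 → X.ncard ≤ 19 := fun X hX hr => ncard_le_nineteen_of_eRk_le_five_of_free M hfree hX hr
  have hflat' : ∀ X ⊆ M.E, M.eRk X ≤ 4 → X.ncard ≤ 10 := fun X hX hr => ncard_le_ten_of_eRk_le_four_of_free M hfree hX hr
  have hU := topCount_le_flat_sharp M 12 57 (by norm_num) (by norm_num) hR hn hfree 19 10 hflat hflat' (by norm_num) (by norm_num)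
    1653 75930 3269652 hs3 hs4 hs5
  have hA := ncard_eRk_le_five_le_flats M 12 57 (by norm_num) hR hn hfree 19 10 hflat hflat' (by norm_num) (by norm_num)
    (by norm_num) (by norm_num) 1653 75930 3269652 hs3 hs4 hs5
  rw [RLS_iff]
  refine c025_core_five_cell_key M 12 57 hn _ hU _ hA (phiK 12 5) (by rw [S2LP.phiK_twelve_five]; norm_num) ?_
  rw [S2LP.phiK_twelve_five]
  norm_num [Finset.sum_range_succ, Finset.sum_Icc_succ_top, Nat.choose]

set_option maxRecDepth 8192 in
/-- **The key cell `(12, 58)`**: `RLS M 12 5` on every `e`-free core of rank `12` on `70` points (caps `1711 / 81077 / 3551518`; `#U ≤ 264115723509794543791021 / 9556831183900`,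
`#{r ≤ 5} ≤ 2380651208318610171366979 / 86011480655100`, `Σ_{s=6}^{11} C(70, s) = 2636351153761`; ratio `0.201`). -/
theorem c025_twelve_key_58 (M : Matroid α) [M.Finite]
    (hR : M.eRank = ((12 : ℕ) : ℕ∞)) (hn : M.E.ncard = 12 + 58)
    (hfree : ∀ e ∈ M.E, ∃ A ⊆ M.E \ {e}, e ∉ M.closure A ∧ e ∉ M.closure ((M.E \ {e}) \ A)) : RLS M 12 5 := by
  classical
  have hd : M.E.encard = M.eRank + ((58 : ℕ) : ℕ∞) := by
    rw [hR, ← M.ground_finite.cast_ncard_eq, hn]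
    push_cast
    ring
  have hs3 := TriangleCap.core_ncard_triangles_le_cq3 M hfree hd
  rw [show TriangleCap.cq3 58 = 1711 by decide] at hs3
  have hs4 := ncard_fourCircuits_le_avgChain16 58 M hfree hd
  rw [show avgChain16 58 = 81077 by decide] at hs4
  have hs5 := S1.ncard_fiveCircuits_le_avgChain5b 58 M hfree hd
  rw [show S1.avgChain5b 58 = 3551518 by decide] at hs5
  have hflat : ∀ X ⊆ M.E, M.eRk X ≤ 5 → X.ncard ≤ 19 := fun X hX hr => ncard_le_nineteen_of_eRk_le_five_of_free M hfree hX hr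
  have hflat' : ∀ X ⊆ M.E, M.eRk X ≤ 4 → X.ncard ≤ 10 := fun X hX hr => ncard_le_ten_of_eRk_le_four_of_free M hfree hX hr
  have hU := topCount_le_flat_sharp M 12 58 (by norm_num) (by norm_num) hR hn hfree 19 10 hflat hflat' (by norm_num) (by norm_num)
    1711 81077 3551518 hs3 hs4 hs5
  have hA := ncard_eRk_le_five_le_flats M 12 58 (by norm_num) hR hn hfree 19 10 hflat hflat' (by norm_num) (by norm_num)
    (by norm_num) (by norm_num) 1711 81077 3551518 hs3 hs4 hs5
  rw [RLS_iff]
  refine c025_core_five_cell_key M 12 58 hn _ hU _ hA (phiK 12 5) (by rw [S2LP.phiK_twelve_five]; norm_num) ?_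
  rw [S2LP.phiK_twelve_five]
  norm_num [Finset.sum_range_succ, Finset.sum_Icc_succ_top, Nat.choose]

set_option maxRecDepth 8192 in
/-- **The key cell `(12, 59)`**: `RLS M 12 5` on every `e`-free core of rank `12` on `71` points (caps `1770 / 86482 / 3852494`; `#U ≤ 435087677050576551948701 / 14335246775850`,
`#{r ≤ 5} ≤ 435735428885031327519221 / 14335246775850`, `Σ_{s=6}^{11} C(71, s) = 3108871551176`; ratio `0.187`). -/
theorem c025_twelve_key_59 (M : Matroid α) [M.Finite]
    (hR : M.eRank = ((12 : ℕ) : ℕ∞)) (hn : M.E.ncard = 12 + 59)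
    (hfree : ∀ e ∈ M.E, ∃ A ⊆ M.E \ {e}, e ∉ M.closure A ∧ e ∉ M.closure ((M.E \ {e}) \ A)) : RLS M 12 5 := by
  classical
  have hd : M.E.encard = M.eRank + ((59 : ℕ) : ℕ∞) := by
    rw [hR, ← M.ground_finite.cast_ncard_eq, hn]
    push_cast
    ring
  have hs3 := TriangleCap.core_ncard_triangles_le_cq3 M hfree hd
  rw [show TriangleCap.cq3 59 = 1770 by decide] at hs3
  have hs4 := ncard_fourCircuits_le_avgChain16 59 M hfree hd
  rw [show avgChain16 59 = 86482 by decide] at hs4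
  have hs5 := S1.ncard_fiveCircuits_le_avgChain5b 59 M hfree hd
  rw [show S1.avgChain5b 59 = 3852494 by decide] at hs5
  have hflat : ∀ X ⊆ M.E, M.eRk X ≤ 5 → X.ncard ≤ 19 := fun X hX hr => ncard_le_nineteen_of_eRk_le_five_of_free M hfree hX hr
  have hflat' : ∀ X ⊆ M.E, M.eRk X ≤ 4 → X.ncard ≤ 10 := fun X hX hr => ncard_le_ten_of_eRk_le_four_of_free M hfree hX hr
  have hU := topCount_le_flat_sharp M 12 59 (by norm_num) (by norm_num) hR hn hfree 19 10 hflat hflat' (by norm_num) (by norm_num)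
    1770 86482 3852494 hs3 hs4 hs5
  have hA := ncard_eRk_le_five_le_flats M 12 59 (by norm_num) hR hn hfree 19 10 hflat hflat' (by norm_num) (by norm_num)
    (by norm_num) (by norm_num) 1770 86482 3852494 hs3 hs4 hs5
  rw [RLS_iff]
  refine c025_core_five_cell_key M 12 59 hn _ hU _ hA (phiK 12 5) (by rw [S2LP.phiK_twelve_five]; norm_num) ?_
  rw [S2LP.phiK_twelve_five]
  norm_num [Finset.sum_range_succ, Finset.sum_Icc_succ_top, Nat.choose]

set_option maxRecDepth 8192 in
/-- **The key cell `(12, 60)`**: `RLS M 12 5` on every `e`-free core of rank `12` on `72` points (caps `1830 / 92152 / 4173535`; `#U ≤ 60910805323601378420917 / 1830031503300`,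
`#{r ≤ 5} ≤ 2866987843310043659451389 / 86011480655100`, `Σ_{s=6}^{11} C(72, s) = 3657208738685`; ratio `0.174`). -/
theorem c025_twelve_key_60 (M : Matroid α) [M.Finite]
    (hR : M.eRank = ((12 : ℕ) : ℕ∞)) (hn : M.E.ncard = 12 + 60)
    (hfree : ∀ e ∈ M.E, ∃ A ⊆ M.E \ {e}, e ∉ M.closure A ∧ e ∉ M.closure ((M.E \ {e}) \ A)) : RLS M 12 5 := by
  classical
  have hd : M.E.encard = M.eRank + ((60 : ℕ) : ℕ∞) := by
    rw [hR, ← M.ground_finite.cast_ncard_eq, hn]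
    push_cast
    ring
  have hs3 := TriangleCap.core_ncard_triangles_le_cq3 M hfree hd
  rw [show TriangleCap.cq3 60 = 1830 by decide] at hs3
  have hs4 := ncard_fourCircuits_le_avgChain16 60 M hfree hd
  rw [show avgChain16 60 = 92152 by decide] at hs4
  have hs5 := S1.ncard_fiveCircuits_le_avgChain5b 60 M hfree hd
  rw [show S1.avgChain5b 60 = 4173535 by decide] at hs5
  have hflat : ∀ X ⊆ M.E, M.eRk X ≤ 5 → X.ncard ≤ 19 := fun X hX hr => ncard_le_nineteen_of_eRk_le_five_of_free M hfree hX hr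
  have hflat' : ∀ X ⊆ M.E, M.eRk X ≤ 4 → X.ncard ≤ 10 := fun X hX hr => ncard_le_ten_of_eRk_le_four_of_free M hfree hX hr
  have hU := topCount_le_flat_sharp M 12 60 (by norm_num) (by norm_num) hR hn hfree 19 10 hflat hflat' (by norm_num) (by norm_num)
    1830 92152 4173535 hs3 hs4 hs5
  have hA := ncard_eRk_le_five_le_flats M 12 60 (by norm_num) hR hn hfree 19 10 hflat hflat' (by norm_num) (by norm_num)
    (by norm_num) (by norm_num) 1830 92152 4173535 hs3 hs4 hs5
  rw [RLS_iff]
  refine c025_core_five_cell_key M 12 60 hn _ hU _ hA (phiK 12 5) (by rw [S2LP.phiK_twelve_five]; norm_num) ?_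
  rw [S2LP.phiK_twelve_five]
  norm_num [Finset.sum_range_succ, Finset.sum_Icc_succ_top, Nat.choose]

set_option maxRecDepth 8192 in
/-- **The key cell `(12, 61)`**: `RLS M 12 5` on every `e`-free core of rank `12` on `73` points (caps `1891 / 98097 / 4515628`; `#U ≤ 1567546594331925856689413 / 43005740327550`,
`#{r ≤ 5} ≤ 1569792048674843213130283 / 43005740327550`, `Σ_{s=6}^{11} C(73, s) = 4292146032562`; ratio `0.163`). -/
theorem c025_twelve_key_61 (M : Matroid α) [M.Finite]
    (hR : M.eRank = ((12 : ℕ) : ℕ∞)) (hn : M.E.ncard = 12 + 61)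
    (hfree : ∀ e ∈ M.E, ∃ A ⊆ M.E \ {e}, e ∉ M.closure A ∧ e ∉ M.closure ((M.E \ {e}) \ A)) : RLS M 12 5 := by
  classical
  have hd : M.E.encard = M.eRank + ((61 : ℕ) : ℕ∞) := by
    rw [hR, ← M.ground_finite.cast_ncard_eq, hn]
    push_cast
    ring
  have hs3 := TriangleCap.core_ncard_triangles_le_cq3 M hfree hd
  rw [show TriangleCap.cq3 61 = 1891 by decide] at hs3
  have hs4 := ncard_fourCircuits_le_avgChain16 61 M hfree hd
  rw [show avgChain16 61 = 98097 by decide] at hs4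
  have hs5 := S1.ncard_fiveCircuits_le_avgChain5b 61 M hfree hd
  rw [show S1.avgChain5b 61 = 4515628 by decide] at hs5
  have hflat : ∀ X ⊆ M.E, M.eRk X ≤ 5 → X.ncard ≤ 19 := fun X hX hr => ncard_le_nineteen_of_eRk_le_five_of_free M hfree hX hr
  have hflat' : ∀ X ⊆ M.E, M.eRk X ≤ 4 → X.ncard ≤ 10 := fun X hX hr => ncard_le_ten_of_eRk_le_four_of_free M hfree hX hr
  have hU := topCount_le_flat_sharp M 12 61 (by norm_num) (by norm_num) hR hn hfree 19 10 hflat hflat' (by norm_num) (by norm_num)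
    1891 98097 4515628 hs3 hs4 hs5
  have hA := ncard_eRk_le_five_le_flats M 12 61 (by norm_num) hR hn hfree 19 10 hflat hflat' (by norm_num) (by norm_num)
    (by norm_num) (by norm_num) 1891 98097 4515628 hs3 hs4 hs5
  rw [RLS_iff]
  refine c025_core_five_cell_key M 12 61 hn _ hU _ hA (phiK 12 5) (by rw [S2LP.phiK_twelve_five]; norm_num) ?_
  rw [S2LP.phiK_twelve_five]
  norm_num [Finset.sum_range_succ, Finset.sum_Icc_succ_top, Nat.choose]

set_option maxRecDepth 8192 in
/-- **The key cell `(12, 62)`**: `RLS M 12 5` on every `e`-free core of rank `12` on `74` points (caps `1953 / 104325 / 4879791`; `#U ≤ 32653557793793723315827 / 819156958620`,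
`#{r ≤ 5} ≤ 6539892525281331952195 / 163831391724`, `Σ_{s=6}^{11} C(74, s) = 5025809716850`; ratio `0.152`). -/
theorem c025_twelve_key_62 (M : Matroid α) [M.Finite]
    (hR : M.eRank = ((12 : ℕ) : ℕ∞)) (hn : M.E.ncard = 12 + 62)
    (hfree : ∀ e ∈ M.E, ∃ A ⊆ M.E \ {e}, e ∉ M.closure A ∧ e ∉ M.closure ((M.E \ {e}) \ A)) : RLS M 12 5 := by
  classical
  have hd : M.E.encard = M.eRank + ((62 : ℕ) : ℕ∞) := by
    rw [hR, ← M.ground_finite.cast_ncard_eq, hn]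
    push_cast
    ring
  have hs3 := TriangleCap.core_ncard_triangles_le_cq3 M hfree hd
  rw [show TriangleCap.cq3 62 = 1953 by decide] at hs3
  have hs4 := ncard_fourCircuits_le_avgChain16 62 M hfree hd
  rw [show avgChain16 62 = 104325 by decide] at hs4
  have hs5 := S1.ncard_fiveCircuits_le_avgChain5b 62 M hfree hd
  rw [show S1.avgChain5b 62 = 4879791 by decide] at hs5
  have hflat : ∀ X ⊆ M.E, M.eRk X ≤ 5 → X.ncard ≤ 19 := fun X hX hr => ncard_le_nineteen_of_eRk_le_five_of_free M hfree hX hr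
  have hflat' : ∀ X ⊆ M.E, M.eRk X ≤ 4 → X.ncard ≤ 10 := fun X hX hr => ncard_le_ten_of_eRk_le_four_of_free M hfree hX hr
  have hU := topCount_le_flat_sharp M 12 62 (by norm_num) (by norm_num) hR hn hfree 19 10 hflat hflat' (by norm_num) (by norm_num)
    1953 104325 4879791 hs3 hs4 hs5
  have hA := ncard_eRk_le_five_le_flats M 12 62 (by norm_num) hR hn hfree 19 10 hflat hflat' (by norm_num) (by norm_num)
    (by norm_num) (by norm_num) 1953 104325 4879791 hs3 hs4 hs5
  rw [RLS_iff]
  refine c025_core_five_cell_key M 12 62 hn _ hU _ hA (phiK 12 5) (by rw [S2LP.phiK_twelve_five]; norm_num) ?_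
  rw [S2LP.phiK_twelve_five]
  norm_num [Finset.sum_range_succ, Finset.sum_Icc_succ_top, Nat.choose]


end ThmN

end PercRepro
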